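import Mathlib
import Literature.Analysis.FluidPDE.VectorCalculus
import Summits.NavierStokesRegularity.NavierStokesRegularity.Theorems.UnthreadedDoorFluxStarvedDipoleGeneralLeverTangency
import HarnessLib

/-!
# Route `UnthreadedDoor`, crux `PoloidalLiouville` (stmt-NavierStokesRegularity-1222), wall W1 — crux idea
# «flux-starved-dipoles» (ns-idea-15 g12/g13, `Cruxes/PoloidalLiouville/FluxStarvedDipoleSketch.lean`):
# `FluxStarvation` — the TIME-DEPENDENT lever (★) on an open time set

The sketch Prop `FluxStarvation` VERBATIM (with `dipolePotentialT`, `dipolePotential`, `IsNonSolidAt`, `KinematicLawOn` unfolded):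
on an open time set `S`, slices `u(t) ∈ C¹` divergence-free, `A, R` jointly `C³` on `S × (0,∞)`, and the time-dependent kinematic
law (E1) `∇(∂ₜT + ⟪u,∇T⟫ − ΔT) × (x−x₀) = ∇⟪u, x−x₀⟫ × ∇T` on `S × {x₀}ᶜ` for the turning-axis dipole potential
`T(t,x) = ⟪A(t,‖x−x₀‖), x−x₀⟫/‖x−x₀‖ + R(t,‖x−x₀‖)` ⇒ at each `t ∈ S` the drift `u(t)` is tangent to every non-solid dipolar
sphere.  As the card says, the `∂ₜT`-term only shifts `ℓ ↦ ℓ − ∂ₜa` in the latitude-independent identity: (E1) is the steady law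
with the reduced scalar `⟪u,∇T⟫ − Ψ`, `Ψ = ΔT − ∂ₜT`, and on `S_r(x₀)` one has `∂ₜT(x₀ + y) = ⟪∂ₜA(t,r), y⟫/r + ∂ₜR(t,r)`
(affine in `y`), so `tangent_of_nonSolid_gen` (`…GeneralLeverTangency`) applies once `Ψ` is known to be differentiable off the
centre — which is where the joint `C³` regularity is used (`slice_hasDerivAt_left`, `slice_fderiv_contDiffOn`: the `t`-partial
`ρ ↦ ∂ₜA(t,ρ) = D(uncurry A)(t,ρ)[(1,0)]` is `C²` on `(0,∞)`; `dipole_contDiffAt_of` for `C^k` data).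

* `fluxStarvation` — the sketch Prop `FluxStarvation`, unfolded.

With `nonSolidDipolarShellAtRestOn_of` (sketch glue) this leaves L0 `SphereTangentUnthreadedVanishes` as the only missing input of
`NonSolidDipolarShellAtRestOn`; K1′ `DipoleNeverAncient` additionally needs the parabolic mean-value step (card §Proof step 5′).
HONEST LABEL: the dipole (`l = 1`) stratum of the LINEAR kinematic shadow of W1 (critic V28: information-grade, W1 movement 0);
`PoloidalLiouville` (1222), its wall `stub_scalarLiouville` and the summit stay OPEN; NO Navier–Stokes regularity statement is
proved.  `--supports stmt-NavierStokesRegularity-1222` (helper).  [folklore]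
-/

noncomputable section

-- the summit and its single sub-problem share the name (CONVENTIONS §1)
set_option linter.dupNamespace false

open Set Filter Topology InnerProductSpace
open scoped RealInnerProductSpace Laplacian
open Literature.Analysis.FluidPDE
open Summit.NavierStokesRegularity.NavierStokesRegularity.Theorems.PoloidalLiouville.HorizonTower (E3)

namespace Summit.NavierStokesRegularity.NavierStokesRegularity.Theorems.PoloidalLiouville.FluxStarvedDipole

/-! ### Slices of jointly smooth data on `S × (0,∞)` -/

/-- The `r`-slice at a time `t ∈ S` of a jointly `C^n` map on `S × (0,∞)` is `C^n` on `(0,∞)`. [folklore] -/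
theorem slice_contDiffOn_right {F : Type*} [NormedAddCommGroup F] [NormedSpace ℝ F] {S : Set ℝ} {A : ℝ → ℝ → F}
    {n : ℕ∞} (hA : ContDiffOn ℝ n (Function.uncurry A) (S ×ˢ Set.Ioi 0)) {t : ℝ} (ht : t ∈ S) :
    ContDiffOn ℝ n (A t) (Set.Ioi 0) := by
  have hf : ContDiffOn ℝ n (fun ρ : ℝ => (t, ρ)) (Set.Ioi 0) := contDiffOn_const.prodMk contDiffOn_id
  have hmaps : Set.MapsTo (fun ρ : ℝ => (t, ρ)) (Set.Ioi 0) (S ×ˢ Set.Ioi 0) := fun ρ hρ => ⟨ht, hρ⟩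
  exact hA.comp hf hmaps

/-- The time derivative of a jointly `C³` map at an interior point: `∂ₜA(t,ρ) = D(uncurry A)(t,ρ)[(1,0)]`. [folklore] -/
theorem slice_hasDerivAt_left {F : Type*} [NormedAddCommGroup F] [NormedSpace ℝ F] {S : Set ℝ} {A : ℝ → ℝ → F}
    (hA : ContDiffOn ℝ 3 (Function.uncurry A) (S ×ˢ Set.Ioi 0)) (hS : IsOpen S) {t ρ : ℝ}
    (ht : t ∈ S) (hρ : 0 < ρ) :
    HasDerivAt (fun s => A s ρ) (fderiv ℝ (Function.uncurry A) (t, ρ) ((1 : ℝ), (0 : ℝ))) t := by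
  have hmem : S ×ˢ Set.Ioi (0 : ℝ) ∈ 𝓝 (t, ρ) := (hS.prod isOpen_Ioi).mem_nhds ⟨ht, hρ⟩
  have hd : DifferentiableAt ℝ (Function.uncurry A) (t, ρ) :=
    (hA.differentiableOn (by norm_num)).differentiableAt hmem
  have hc : HasDerivAt (fun s : ℝ => (s, ρ)) ((1 : ℝ), (0 : ℝ)) t := (hasDerivAt_id t).prodMk (hasDerivAt_const t ρ)
  exact hd.hasFDerivAt.comp_hasDerivAt t hc

/-- The time derivative `ρ ↦ ∂ₜA(t,ρ)` of a jointly `C³` map is `C²` in `ρ` on `(0,∞)`. [folklore] -/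
theorem slice_fderiv_contDiffOn {F : Type*} [NormedAddCommGroup F] [NormedSpace ℝ F] {S : Set ℝ} {A : ℝ → ℝ → F}
    (hA : ContDiffOn ℝ 3 (Function.uncurry A) (S ×ˢ Set.Ioi 0)) (hS : IsOpen S) {t : ℝ} (ht : t ∈ S) :
    ContDiffOn ℝ 2 (fun ρ : ℝ => fderiv ℝ (Function.uncurry A) (t, ρ) ((1 : ℝ), (0 : ℝ))) (Set.Ioi 0) := by
  have h1 : ContDiffOn ℝ 2 (fderiv ℝ (Function.uncurry A)) (S ×ˢ Set.Ioi 0) :=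
    hA.fderiv_of_isOpen (hS.prod isOpen_Ioi) (by norm_num)
  have hf : ContDiffOn ℝ 2 (fun ρ : ℝ => (t, ρ)) (Set.Ioi 0) := contDiffOn_const.prodMk contDiffOn_id
  have h2 := h1.comp hf (fun ρ hρ => ⟨ht, hρ⟩)
  exact h2.clm_apply contDiffOn_const

/-- `C^k` version of `dipole_contDiffAt`: the turning-axis dipole expression with `C^k` moment and radial data is `C^k` off the
centre. [folklore] -/
theorem dipole_contDiffAt_of {k : ℕ∞} {A : ℝ → E3} {R : ℝ → ℝ} {x₀ x : E3} {T : E3 → ℝ}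
    (hT : ∀ z, T z = ⟪A ‖z - x₀‖, z - x₀⟫ / ‖z - x₀‖ + R ‖z - x₀‖)
    (hA : ContDiffOn ℝ k A (Ioi 0)) (hR : ContDiffOn ℝ k R (Ioi 0)) (hx : x ≠ x₀) :
    ContDiffAt ℝ k T x := by
  have hfun : T = fun z => ⟪A ‖z - x₀‖, z - x₀⟫ / ‖z - x₀‖ + R ‖z - x₀‖ := funext hT
  have hsub : ContDiffAt ℝ k (fun z : E3 => z - x₀) x := contDiffAt_id.sub contDiffAt_const
  have hne : x - x₀ ≠ 0 := sub_ne_zero.mpr hx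
  have hn : ContDiffAt ℝ k (fun z : E3 => ‖z - x₀‖) x := hsub.norm ℝ hne
  have hpos : ‖x - x₀‖ ∈ Ioi (0 : ℝ) := norm_pos_iff.mpr hne
  have hA' : ContDiffAt ℝ k (fun z : E3 => A ‖z - x₀‖) x := (hA.contDiffAt (Ioi_mem_nhds hpos)).comp x hn
  have hR' : ContDiffAt ℝ k (fun z : E3 => R ‖z - x₀‖) x := (hR.contDiffAt (Ioi_mem_nhds hpos)).comp x hn
  rw [hfun]
  exact ((hA'.inner ℝ hsub).div hn (norm_ne_zero_iff.mpr hne)).add hR'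

/-! ### Flux starvation on a time window -/

/-- **FLUX STARVATION, time-dependent form** — the sketch Prop `FluxStarvedDipole.FluxStarvation` VERBATIM (with
`dipolePotentialT`, `dipolePotential`, `IsNonSolidAt`, `KinematicLawOn` unfolded): on an open time set `S`, slices `u(t) ∈ C¹`
divergence-free, `A, R` jointly `C³` on `S × (0,∞)`, the time-dependent kinematic law (E1) on `S × {x₀}ᶜ` for the turning-axis
dipole potential ⇒ at each `t ∈ S`, `u(t)` is tangent to every non-solid dipolar sphere `S_r(x₀)` (`A(t,r) ≠ 0`,
`r(‖A(t,·)‖)′(r) ≠ ‖A(t,r)‖`).  Proof: (E1) is the steady law with reduced scalar `⟪u,∇T⟫ − Ψ`, `Ψ = ΔT − ∂ₜT`, and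
`∂ₜT(x₀ + y) = ⟪∂ₜA(t,r), y⟫/r + ∂ₜR(t,r)` on `S_r(x₀)`; apply `tangent_of_nonSolid_gen`. [folklore] -/
theorem fluxStarvation :
    ∀ (S : Set ℝ) (u : ℝ → E3 → E3) (x₀ : E3) (A : ℝ → ℝ → E3) (R : ℝ → ℝ → ℝ), IsOpen S →
      (∀ t ∈ S, ContDiff ℝ 1 (u t)) → (∀ t ∈ S, Literature.Analysis.FluidPDE.VectorCalculus.IsDivFree (u t)) →
      ContDiffOn ℝ 3 (Function.uncurry A) (S ×ˢ Set.Ioi 0) → ContDiffOn ℝ 3 (Function.uncurry R) (S ×ˢ Set.Ioi 0) →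
      (∀ t ∈ S, ∀ x, x ≠ x₀ →
        cross (gradient (fun z => deriv (fun s => ⟪A s ‖z - x₀‖, z - x₀⟫ / ‖z - x₀‖ + R s ‖z - x₀‖) t
            + ⟪u t z, gradient (fun x => ⟪A t ‖x - x₀‖, x - x₀⟫ / ‖x - x₀‖ + R t ‖x - x₀‖) z⟫
            - Δ (fun x => ⟪A t ‖x - x₀‖, x - x₀⟫ / ‖x - x₀‖ + R t ‖x - x₀‖) z) x) (x - x₀)
          = cross (gradient (fun z => ⟪u t z, z - x₀⟫) x)
              (gradient (fun x => ⟪A t ‖x - x₀‖, x - x₀⟫ / ‖x - x₀‖ + R t ‖x - x₀‖) x)) →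
      ∀ t ∈ S, ∀ r > 0, (A t r ≠ 0 ∧ r * deriv (fun s => ‖A t s‖) r ≠ ‖A t r‖) →
        ∀ x, ‖x - x₀‖ = r → ⟪u t x, x - x₀⟫ = 0 := by
  intro S u x₀ A R hS hu hdiv hA hR hlaw t ht r hr hns x hx
  obtain ⟨hAr, hsol⟩ := hns
  -- the slices at time `t`
  have hAt : ContDiffOn ℝ 3 (A t) (Ioi 0) := slice_contDiffOn_right hA ht
  have hRt : ContDiffOn ℝ 3 (R t) (Ioi 0) := slice_contDiffOn_right hR ht
  set T : E3 → ℝ := fun x => ⟪A t ‖x - x₀‖, x - x₀⟫ / ‖x - x₀‖ + R t ‖x - x₀‖ with hTdef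
  have hT : ∀ z, T z = ⟪A t ‖z - x₀‖, z - x₀⟫ / ‖z - x₀‖ + R t ‖z - x₀‖ := fun z => rfl
  -- the time partials `∂ₜA(t,·)`, `∂ₜR(t,·)` and the time derivative of the potential off the centre
  obtain ⟨A₁, hA₁⟩ : ∃ A₁ : ℝ → E3, A₁ = fun ρ => fderiv ℝ (Function.uncurry A) (t, ρ) ((1 : ℝ), (0 : ℝ)) := ⟨_, rfl⟩
  obtain ⟨R₁, hR₁⟩ : ∃ R₁ : ℝ → ℝ, R₁ = fun ρ => fderiv ℝ (Function.uncurry R) (t, ρ) ((1 : ℝ), (0 : ℝ)) := ⟨_, rfl⟩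
  have hA₁c : ContDiffOn ℝ 2 A₁ (Ioi 0) := by rw [hA₁]; exact slice_fderiv_contDiffOn hA hS ht
  have hR₁c : ContDiffOn ℝ 2 R₁ (Ioi 0) := by rw [hR₁]; exact slice_fderiv_contDiffOn hR hS ht
  obtain ⟨Td, hTd⟩ : ∃ Td : E3 → ℝ, Td = fun z => ⟪A₁ ‖z - x₀‖, z - x₀⟫ / ‖z - x₀‖ + R₁ ‖z - x₀‖ := ⟨_, rfl⟩
  have hTd' : ∀ z, Td z = ⟪A₁ ‖z - x₀‖, z - x₀⟫ / ‖z - x₀‖ + R₁ ‖z - x₀‖ := fun z => by rw [hTd]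
  have hdot : ∀ z : E3, z ≠ x₀ →
      deriv (fun s => ⟪A s ‖z - x₀‖, z - x₀⟫ / ‖z - x₀‖ + R s ‖z - x₀‖) t = Td z := by
    intro z hz
    have hρ : 0 < ‖z - x₀‖ := norm_pos_iff.mpr (sub_ne_zero.mpr hz)
    have h1 : HasDerivAt (fun s => A s ‖z - x₀‖) (A₁ ‖z - x₀‖) t := by
      rw [hA₁]; exact slice_hasDerivAt_left hA hS ht hρ
    have h2 : HasDerivAt (fun s => R s ‖z - x₀‖) (R₁ ‖z - x₀‖) t := by
      rw [hR₁]; exact slice_hasDerivAt_left hR hS ht hρ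
    have h : HasDerivAt (fun s => ⟪A s ‖z - x₀‖, z - x₀⟫ / ‖z - x₀‖ + R s ‖z - x₀‖)
        ((⟪A t ‖z - x₀‖, (0 : E3)⟫ + ⟪A₁ ‖z - x₀‖, z - x₀⟫) / ‖z - x₀‖ + R₁ ‖z - x₀‖) t :=
      ((h1.inner ℝ (hasDerivAt_const t (z - x₀))).div_const ‖z - x₀‖).add h2
    rw [h.deriv, hTd', inner_zero_right, zero_add]
  -- the reduced scalar `Ψ = ΔT − ∂ₜT`: differentiable off the centre, `ΔT +` affine on the sphere
  obtain ⟨Ψ, hΨ⟩ : ∃ Ψ : E3 → ℝ, Ψ = fun z => Δ T z - Td z := ⟨_, rfl⟩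
  have hΨd : ∀ z : E3, z ≠ x₀ → DifferentiableAt ℝ Ψ z := by
    intro z hz
    have h3 := dipole_contDiffAt hT hAt hRt hz
    have h4 : ContDiffAt ℝ 2 Td z := dipole_contDiffAt_of hTd' hA₁c hR₁c hz
    rw [hΨ]
    exact (dipole_differentiableAt_laplacian h3).sub (h4.differentiableAt (by norm_num))
  have hΨs : ∀ y : E3, ‖y‖ = r → Ψ (x₀ + y) = Δ T (x₀ + y) + ⟪-(r⁻¹ • A₁ r), y⟫ + (-(R₁ r)) := by
    intro y hy
    rw [hΨ, hTd]
    simp only [add_sub_cancel_left, hy]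
    rw [inner_neg_left, real_inner_smul_left, div_eq_inv_mul]
    ring
  -- (E1) at time `t` is the steady law with reduced scalar `⟪u,∇T⟫ − Ψ`
  have hlaw' : ∀ x ∈ ({x₀}ᶜ : Set E3),
      cross (gradient (fun z => ⟪u t z, gradient T z⟫ - Ψ z) x) (x - x₀)
        = cross (gradient (fun z => ⟪u t z, z - x₀⟫) x) (gradient T x) := by
    intro x hx'
    have hxne : x ≠ x₀ := hx'
    have h := hlaw t ht x hxne
    have hev : (fun z => deriv (fun s => ⟪A s ‖z - x₀‖, z - x₀⟫ / ‖z - x₀‖ + R s ‖z - x₀‖) t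
        + ⟪u t z, gradient T z⟫ - Δ T z) =ᶠ[𝓝 x] (fun z => ⟪u t z, gradient T z⟫ - Ψ z) := by
      filter_upwards [isOpen_compl_singleton.mem_nhds hxne] with z hz
      rw [hdot z hz, hΨ]
      ring
    have hg : gradient (fun z => deriv (fun s => ⟪A s ‖z - x₀‖, z - x₀⟫ / ‖z - x₀‖ + R s ‖z - x₀‖) t
        + ⟪u t z, gradient T z⟫ - Δ T z) x = gradient (fun z => ⟪u t z, gradient T z⟫ - Ψ z) x :=
      hev.gradient_eq
    rw [← hg]
    exact h
  -- the general lever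
  exact tangent_of_nonSolid_gen (u t) x₀ (A t) (R t) (hu t ht) (hdiv t ht) hAt hRt hlaw' hr hAr hsol hΨd hΨs x hx

end Summit.NavierStokesRegularity.NavierStokesRegularity.Theorems.PoloidalLiouville.FluxStarvedDipole

end
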